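import Literature.AlgebraicGeometry.Hyperkaehler.LooijengaLuntsVerbitsky
import Literature.Algebra.Lie.LefschetzModule
import HarnessLib

/-!
# Total cohomology as a Lefschetz module: hard Lefschetz ⇒ the `𝔰𝔩(2)`-partner exists (Looijenga–Lunts 1997, §1 (1.1), "by Jacobson–Morozov")

Layer `Literature/AlgebraicGeometry/Hyperkaehler`, rider on `LooijengaLuntsVerbitsky.lean` (whose docstring of
`HasDualLefschetz` records: "by Jacobson–Morozov equivalent to `L_aᵏ : H^{N-k} ≅ H^{N+k}` for all `k`, the tree's
`Geometry.Kaehler.HasHardLefschetzProperty a N` — an equivalence not proved here").  This file PROVES the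
implication used by every consumer: it identifies the tree's concrete data — total cohomology
`H*(Y; K) = ⨁ₖ Hᵏ(Y; K)` (`totalCohomology`), the degree operator `h = degreeOperator K Y N` (multiplication by
`k - N` on `Hᵏ`) and the Lefschetz operator `L_a = totalLefschetz a` — with an abstract finite-dimensional
`ℤ`-graded Lefschetz module `(M, h, e)` in the sense of `Literature.Algebra.Lie.LefschetzModule` (lit-hodgefound row
A1-88: the graded Jacobson–Morozov lemma, PROVED there), as soon as `a` has the hard Lefschetz property in dimension
`N` and `Hᵏ(Y; K) = 0` for `k > 2N`.  DEFINITIONS: none.  All theorems PROVED (no named fact, no `sorry`; D-0026 net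
debt `0`).

## Sources, VERBATIM

E. Looijenga, V. A. Lunts, *A Lie algebra attached to a projective variety*, Invent. Math. **129** (1997) 361–412
(held `paper:arxiv-alg-geom_9604014`), §1 (1.1) p. 3 L106 – p. 4 L5: "Let `M` be a `ℤ`-graded `K`-vector space of
finite dimension and denote by `h : M → M` the transformation that is multiplication by `k` in degree `k`. […] We say
that a linear transformation `e : M → M` of degree `2` has the Lefschetz property if for all integers `k ≥ 0`, `e^k`
maps `M_{-k}` isomorphically onto `M_k`. According to the Jacobson–Morozov lemma this is equivalent to the existence
of `K`-linear transformation `f` in `M` of degree `-2` such that `[e, f] = h`. This `f` is then unique and `(e, h, f)`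
is a `𝔰𝔩(2)`-triple"; p. 4 ("`M = H(X)[n]`": the cohomology of a compact Kähler `n`-fold graded by `k - n`).

## Dictionary

* `M = totalCohomology K Y = ⨁ₖ Hᵏ(Y; K)`, `h = degreeOperator K Y N`; the abstract degree part
  `Algebra.Lie.degreeSpace h m` (`m : ℤ`, the eigenspace of `h` for `m`) IS the summand `H^{m+N}`
  (`degreeSpace_degreeOperator_eq_range`: `= range (ofDegree K Y n)` for `n - N = m`; `= ⊥` for `m + N < 0`,
  `degreeSpace_degreeOperator_eq_bot`), and `(M, h)` is `ℤ`-graded (`isZGrading_degreeOperator`).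
* `e = totalLefschetz a`: `eʲ` is `Lʲ = lefschetzPow a j` summand-wise (`pow_totalLefschetz_ofDegree`), so the tree's
  `Geometry.Kaehler.HasHardLefschetzProperty a N` (`Lʲ : Hᵏ ≅ H^{k+2j}` bijective for `k + j = N`) together with the
  vanishing `Hᵏ(Y; K) = 0` for `k > 2N` (needed for the degrees `M_m`, `|m| > N`, which the abstract Lefschetz
  property also constrains) IS `Algebra.Lie.HasLefschetzProperty h e` (`hasLefschetzProperty_totalLefschetz`).
* Consequently (`hasDualLefschetz_of_hasHardLefschetzProperty`): for `H*(Y; K)` finite-dimensional and `h ≠ 0`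
  (Mathlib's `IsSl2Triple` convention; `degreeOperator_ne_zero_of_ne_zero`: some `Hᵏ ≠ 0` with `k ≠ N`), a
  hard-Lefschetz class HAS a dual Lefschetz operator — `HasDualLefschetz N a`, witnessed by the explicit partner
  `HasLefschetzProperty.dual` (André's `ᶜΛ`), unique by `Algebra.Lie.dualPartner_unique`.

## SCOPE

`K` is a field of characteristic `0` (the abstract layer's standing hypothesis).  The converse implication
(`IsDualLefschetz ⇒ HasHardLefschetzProperty`, Looijenga–Lunts' other direction, abstractly
`Algebra.Lie.hasLefschetzProperty_of_isSl2Triple`) IS transported (`hasHardLefschetzProperty_of_isDualLefschetz`,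
`hasDualLefschetz_iff_hasHardLefschetzProperty`, appended).  Nothing in this file concerns a particular space `Y`;
the smooth projective case is the sequel `HodgeTheory/DualLefschetzInLefschetzInvolutionAlgebraHolds.lean`.
-/

noncomputable section

open DirectSum Module Function Set
open Literature.AlgebraicTopology.SingularHomology
open Literature.Geometry.Kaehler
open Literature.Algebra.Lie

universe u v

namespace Literature.AlgebraicGeometry.Hyperkaehler

variable {K : Type v} [Field K] {Y : Type u} [TopologicalSpace Y]

/-! ### The degree operator on components and its eigenspaces -/

/-- **`h` on components**: `(h v)ⱼ = (j - N) · vⱼ` for `v ∈ H*(Y; K) = ⨁ⱼ Hʲ`.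
[cite: LooijengaLunts1997, §1 (1.1) p. 3 ("h … multiplication by k in degree k")] -/
theorem degreeOperator_apply_apply (N : ℕ) (v : totalCohomology K Y) (j : ℕ) :
    degreeOperator K Y N v j = ((j : K) - N) • v j := by
  induction v using DirectSum.induction_on with
  | zero => rw [map_zero, DirectSum.zero_apply, smul_zero]
  | of i x =>
    rw [← DirectSum.lof_eq_of K, degreeOperator_lof, DirectSum.smul_apply, DirectSum.lof_eq_of]
    by_cases hij : i = j
    · subst hij
      rfl
    · rw [DirectSum.of_eq_of_ne (β := fun k ↦ singularCohomology K K Y k) i j x (Ne.symm hij), smul_zero,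
        smul_zero]
  | add v w hv hw => rw [map_add, DirectSum.add_apply, DirectSum.add_apply, hv, hw, smul_add]

/-- **Eigenvectors of `h`**: `v ∈ H*(Y; K)` satisfies `h v = μ v` iff its components `vⱼ` vanish in every degree
`j` with `j - N ≠ μ`. [cite: LooijengaLunts1997, §1 (1.1) p. 3] -/
theorem mem_eigenspace_degreeOperator_iff (N : ℕ) (μ : K) (v : totalCohomology K Y) :
    v ∈ Module.End.eigenspace (degreeOperator K Y N) μ ↔ ∀ j : ℕ, ((j : K) - N) ≠ μ → v j = 0 := by
  rw [Module.End.mem_eigenspace_iff]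
  constructor
  · intro hv j hj
    have h1 : degreeOperator K Y N v j = (μ • v) j := by rw [hv]
    rw [degreeOperator_apply_apply, DirectSum.smul_apply, ← sub_eq_zero, ← sub_smul, smul_eq_zero] at h1
    exact h1.resolve_left (sub_ne_zero.2 hj)
  · intro hv
    refine DirectSum.ext _ fun j ↦ ?_
    rw [degreeOperator_apply_apply, DirectSum.smul_apply]
    by_cases hj : ((j : K) - N) = μ
    · rw [hj]
    · rw [hv j hj, smul_zero, smul_zero]

/-- Every summand `Hⁿ(Y; K)` lies in the degree part `M_{n-N}` of `(H*(Y; K), h)`.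
[cite: LooijengaLunts1997, §1 (1.1) p. 3 and p. 4 ("M = H(X)[n]")] -/
theorem ofDegree_mem_degreeSpace (N n : ℕ) {m : ℤ} (hm : (n : ℤ) - N = m) (x : singularCohomology K K Y n) :
    ofDegree K Y n x ∈ degreeSpace (degreeOperator K Y N) m := by
  rw [mem_degreeSpace_iff, degreeOperator_lof, ← hm, Int.cast_sub, Int.cast_natCast, Int.cast_natCast]

variable [CharZero K]

/-- **The degree part `M_m` of `(H*(Y; K), h)` is the summand `Hⁿ(Y; K)`, `n - N = m`** (characteristic `0`:
distinct degrees give distinct eigenvalues). [cite: LooijengaLunts1997, §1 (1.1) p. 3 and p. 4 ("M = H(X)[n]")] -/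
theorem degreeSpace_degreeOperator_eq_range (N n : ℕ) {m : ℤ} (hm : (n : ℤ) - N = m) :
    degreeSpace (degreeOperator K Y N) m = LinearMap.range (ofDegree K Y n) := by
  refine le_antisymm (fun v hv ↦ ?_) ?_
  · rw [degreeSpace, mem_eigenspace_degreeOperator_iff] at hv
    refine ⟨v n, DirectSum.ext _ fun j ↦ ?_⟩
    by_cases hjn : n = j
    · subst hjn
      rw [DirectSum.lof_eq_of, DirectSum.of_eq_same (β := fun k ↦ singularCohomology K K Y k) n (v n)]
    · rw [DirectSum.lof_eq_of, DirectSum.of_eq_of_ne (β := fun k ↦ singularCohomology K K Y k) n j (v n)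
        (Ne.symm hjn), hv j]
      intro hj
      apply hjn
      have h1 : ((j : ℤ) : K) - ((N : ℤ) : K) = ((m : ℤ) : K) := by push_cast at hj ⊢; exact hj
      rw [← Int.cast_sub, Int.cast_inj] at h1
      omega
  · rintro _ ⟨x, rfl⟩
    exact ofDegree_mem_degreeSpace N n hm x

/-- Below the bottom degree the degree parts vanish: `M_m = 0` for `m + N < 0`.
[cite: LooijengaLunts1997, §1 (1.1) p. 4 ("M = H(X)[n]")] -/
theorem degreeSpace_degreeOperator_eq_bot (N : ℕ) {m : ℤ} (hm : m + N < 0) :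
    degreeSpace (degreeOperator K Y N) m = ⊥ := by
  rw [Submodule.eq_bot_iff]
  intro v hv
  rw [degreeSpace, mem_eigenspace_degreeOperator_iff] at hv
  refine DirectSum.ext _ fun j ↦ ?_
  rw [DirectSum.zero_apply, hv j]
  intro hj
  have h1 : ((j : ℤ) : K) - ((N : ℤ) : K) = ((m : ℤ) : K) := by push_cast at hj ⊢; exact hj
  rw [← Int.cast_sub, Int.cast_inj] at h1
  omega

omit [CharZero K] in
/-- **`(H*(Y; K), h)` is `ℤ`-graded**: `H* = ⨁ₘ M_m`. [cite: LooijengaLunts1997, §1 (1.1) p. 3 ("a ℤ-graded K-vector space")] -/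
theorem isZGrading_degreeOperator (N : ℕ) : IsZGrading (degreeOperator K Y N) := by
  rw [IsZGrading, eq_top_iff]
  rintro v -
  induction v using DirectSum.induction_on with
  | zero => exact Submodule.zero_mem _
  | of i x =>
    rw [← DirectSum.lof_eq_of K]
    exact le_iSup (fun m : ℤ ↦ degreeSpace (degreeOperator K Y N) m) ((i : ℤ) - N)
      (ofDegree_mem_degreeSpace N i rfl x)
  | add v w hv hw => exact Submodule.add_mem _ hv hw

/-- **`h ≠ 0` as soon as some `Hᵏ(Y; K) ≠ 0` with `k ≠ N`** (on it `h` is the non-zero scalar `k - N`; this is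
Mathlib's side condition in `IsSl2Triple`). [cite: LooijengaLunts1997, §1 (1.1) p. 4] -/
theorem degreeOperator_ne_zero_of_ne_zero {N k : ℕ} (hk : k ≠ N) {x : singularCohomology K K Y k} (hx : x ≠ 0) :
    degreeOperator K Y N ≠ 0 := by
  intro h0
  have h1 := LinearMap.congr_fun h0 (ofDegree K Y k x)
  rw [degreeOperator_lof, LinearMap.zero_apply, smul_eq_zero] at h1
  rcases h1 with h1 | h1
  · have h2 : ((k : ℤ) : K) = ((N : ℤ) : K) := by push_cast; exact sub_eq_zero.1 h1
    rw [Int.cast_inj] at h2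
    exact hk (by exact_mod_cast h2)
  · exact hx (DirectSum.of_injective (β := fun k ↦ singularCohomology K K Y k) k
      (by rw [← DirectSum.lof_eq_of K]; rw [h1, map_zero]))

/-! ### The Lefschetz operator and the Lefschetz property -/

omit [CharZero K] in
/-- **`L_aʲ` on a summand is the tree's iterated Lefschetz operator**: `L_aʲ (x in degree n) = (Lʲ x in degree
n + 2j)`. [cite: LooijengaLunts1997, §1 p. 4 (e_a)] -/
theorem pow_totalLefschetz_ofDegree (a : singularCohomology K K Y 2) (j n : ℕ) (x : singularCohomology K K Y n) :
    (totalLefschetz a ^ j) (ofDegree K Y n x) = ofDegree K Y (n + 2 * j) (lefschetzPow a j n x) := by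
  induction j with
  | zero => rfl
  | succ j ih =>
    rw [pow_succ', Module.End.mul_apply, ih, totalLefschetz_lof, lefschetzPow_succ, LinearMap.comp_apply]
    rfl

/-- **Hard Lefschetz IS the Lefschetz property of `(H*(Y; K), h, L_a)`**: if `Lʲ : Hᵏ(Y; K) → H^{k+2j}(Y; K)` is
bijective for `k + j = N` (`HasHardLefschetzProperty a N`) and `Hᵏ(Y; K) = 0` for `k > 2N`, then `L_a` is an operator
of degree `2` with `L_aᵏ : M_{-k} ≅ M_k` for all `k ≥ 0` ("e^k maps M_{-k} isomorphically onto M_k"; for `k > N` both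
sides are `0`). [cite: LooijengaLunts1997, §1 (1.1) p. 4 L1–L2 and p. 4 ("M = H(X)[n]")] -/
theorem hasLefschetzProperty_totalLefschetz {N : ℕ} (a : singularCohomology K K Y 2)
    (hHL : HasHardLefschetzProperty a N) (hvan : ∀ k, 2 * N < k → ∀ x : singularCohomology K K Y k, x = 0) :
    HasLefschetzProperty (degreeOperator K Y N) (totalLefschetz a) where
  mapsTo := mapsTo_of_lie_eq_two_nsmul (lie_degreeOperator_totalLefschetz N a)
  bijOn k := by
    rcases le_or_gt k N with hkN | hkN
    · -- `M_{-k} = H^{N-k}`, `M_k = H^{N+k}`, and `Lᵏ : H^{N-k} ≅ H^{N+k}`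
      obtain ⟨n, rfl⟩ : ∃ n, N = n + k := ⟨N - k, by omega⟩
      rw [degreeSpace_degreeOperator_eq_range (n + k) n (by push_cast; ring),
        degreeSpace_degreeOperator_eq_range (n + k) (n + 2 * k) (by push_cast; ring)]
      refine ⟨?_, ?_, ?_⟩
      · rintro _ ⟨x, rfl⟩
        exact ⟨lefschetzPow a k n x, (pow_totalLefschetz_ofDegree a k n x).symm⟩
      · rintro _ ⟨x, rfl⟩ _ ⟨y, rfl⟩ hxy
        rw [pow_totalLefschetz_ofDegree, pow_totalLefschetz_ofDegree] at hxy
        have h1 := DirectSum.of_injective (β := fun k ↦ singularCohomology K K Y k) (n + 2 * k) hxy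
        rw [(hHL k n rfl).1 h1]
      · rintro _ ⟨y, rfl⟩
        obtain ⟨x, rfl⟩ := (hHL k n rfl).2 y
        exact ⟨ofDegree K Y n x, ⟨x, rfl⟩, pow_totalLefschetz_ofDegree a k n x⟩
    · -- both degree parts vanish
      have h1 : degreeSpace (degreeOperator K Y N) (-(k : ℤ)) = ⊥ :=
        degreeSpace_degreeOperator_eq_bot N (by omega)
      have h2 : degreeSpace (degreeOperator K Y N) (k : ℤ) = ⊥ := by
        rw [degreeSpace_degreeOperator_eq_range N (N + k) (by push_cast; ring), LinearMap.range_eq_bot]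
        ext x
        rw [hvan (N + k) (by omega) x, map_zero, LinearMap.zero_apply]
      rw [h1, h2, Submodule.bot_coe]
      exact Set.bijOn_singleton.2 (map_zero _)

/-- **Hard Lefschetz ⇒ a dual Lefschetz operator exists** ("According to the Jacobson–Morozov lemma this is
equivalent to the existence of … `f` … such that `[e, f] = h` … and `(e, h, f)` is a `𝔰𝔩(2)`-triple"): for `H*(Y; K)`
finite-dimensional with `Hᵏ = 0` for `k > 2N` and `h ≠ 0`, a class `a` with the hard Lefschetz property in
dimension `N` has the Lefschetz property `HasDualLefschetz N a` of `LooijengaLuntsVerbitsky`, witnessed by the abstract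
partner `HasLefschetzProperty.dual` (André's `ᶜΛ`). [cite: LooijengaLunts1997, §1 (1.1) p. 4 L1–L5] -/
theorem hasDualLefschetz_of_hasHardLefschetzProperty [Module.Finite K (totalCohomology K Y)] {N : ℕ}
    (a : singularCohomology K K Y 2) (hHL : HasHardLefschetzProperty a N)
    (hvan : ∀ k, 2 * N < k → ∀ x : singularCohomology K K Y k, x = 0) (h0 : degreeOperator K Y N ≠ 0) :
    HasDualLefschetz N a :=
  ⟨(hasLefschetzProperty_totalLefschetz a hHL hvan).dual (isZGrading_degreeOperator N),
    (hasLefschetzProperty_totalLefschetz a hHL hvan).isSl2Triple_dual (isZGrading_degreeOperator N) h0⟩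

/-- Under the same hypotheses **every dual Lefschetz operator of `a` IS the abstract partner `ᶜΛ`** (uniqueness,
`Algebra.Lie.dualPartner_unique`). [cite: LooijengaLunts1997, §1 (1.1) p. 4 L4 ("This f is then unique")] -/
theorem IsDualLefschetz.eq_dual [Module.Finite K (totalCohomology K Y)] {N : ℕ} {a : singularCohomology K K Y 2}
    (hHL : HasHardLefschetzProperty a N) (hvan : ∀ k, 2 * N < k → ∀ x : singularCohomology K K Y k, x = 0)
    {Λ : Module.End K (totalCohomology K Y)} (hΛ : IsDualLefschetz N a Λ) :
    Λ = (hasLefschetzProperty_totalLefschetz a hHL hvan).dual (isZGrading_degreeOperator N) :=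
  (hasLefschetzProperty_totalLefschetz a hHL hvan).eq_dual_of_isSl2Triple (isZGrading_degreeOperator N) hΛ

/-! ### The converse: an `𝔰𝔩(2)`-partner forces hard Lefschetz (Looijenga–Lunts (1.1), "⇐") -/

/-- **A dual Lefschetz operator forces the hard Lefschetz property**: if `(L_a, h, Λ)` is an `𝔰𝔩(2)`-triple on
the finite-dimensional `H*(Y; K)` (`IsDualLefschetz N a Λ`), then `Lʲ : Hᵏ(Y; K) → H^{k+2j}(Y; K)` is bijective for
`k + j = N` — the abstract converse `Algebra.Lie.hasLefschetzProperty_of_isSl2Triple` (nilpotent `e`, `f` and the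
`𝔰𝔩₂`-string lemmas) read on the summands `M_{-j} = Hᵏ`, `M_j = H^{k+2j}`.  No vanishing hypothesis is needed in
this direction. [cite: LooijengaLunts1997, §1 (1.1) p. 4 L1–L5 ("this is equivalent to the existence of … f")] -/
theorem hasHardLefschetzProperty_of_isDualLefschetz [Module.Finite K (totalCohomology K Y)] {N : ℕ}
    {a : singularCohomology K K Y 2} {Λ : Module.End K (totalCohomology K Y)} (hΛ : IsDualLefschetz N a Λ) :
    HasHardLefschetzProperty a N := by
  have L : HasLefschetzProperty (degreeOperator K Y N) (totalLefschetz a) :=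
    hasLefschetzProperty_of_isSl2Triple (isZGrading_degreeOperator N) hΛ
  intro j k hkj
  have hB := L.bijOn j
  rw [degreeSpace_degreeOperator_eq_range N k (by rw [← hkj]; push_cast; ring),
    degreeSpace_degreeOperator_eq_range N (k + 2 * j) (by rw [← hkj]; push_cast; ring)] at hB
  constructor
  · intro x y hxy
    have h1 : (totalLefschetz a ^ j) (ofDegree K Y k x) = (totalLefschetz a ^ j) (ofDegree K Y k y) := by
      rw [pow_totalLefschetz_ofDegree, pow_totalLefschetz_ofDegree, hxy]
    exact DirectSum.of_injective (β := fun k ↦ singularCohomology K K Y k) k (hB.injOn ⟨x, rfl⟩ ⟨y, rfl⟩ h1)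
  · intro z
    obtain ⟨v, ⟨x, rfl⟩, hv⟩ := hB.surjOn (show ofDegree K Y (k + 2 * j) z ∈
      (LinearMap.range (ofDegree K Y (k + 2 * j)) : Set (totalCohomology K Y)) from ⟨z, rfl⟩)
    rw [pow_totalLefschetz_ofDegree] at hv
    exact ⟨x, DirectSum.of_injective (β := fun k ↦ singularCohomology K K Y k) (k + 2 * j) hv⟩

/-- **Looijenga–Lunts (1.1) on the real carriers: for `H*(Y; K)` finite-dimensional with `Hᵏ = 0` for `k > 2N` and
`h ≠ 0`, a class `a ∈ H²(Y; K)` has a dual Lefschetz operator iff it has the hard Lefschetz property in dimension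
`N`** ("According to the Jacobson–Morozov lemma this is equivalent to the existence of `K`-linear transformation `f`
in `M` of degree `-2` such that `[e, f] = h`"). [cite: LooijengaLunts1997, §1 (1.1) p. 4 L1–L5] -/
theorem hasDualLefschetz_iff_hasHardLefschetzProperty [Module.Finite K (totalCohomology K Y)] {N : ℕ}
    (a : singularCohomology K K Y 2) (hvan : ∀ k, 2 * N < k → ∀ x : singularCohomology K K Y k, x = 0)
    (h0 : degreeOperator K Y N ≠ 0) : HasDualLefschetz N a ↔ HasHardLefschetzProperty a N :=
  ⟨fun ⟨_, hΛ⟩ ↦ hasHardLefschetzProperty_of_isDualLefschetz hΛ,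
    fun hHL ↦ hasDualLefschetz_of_hasHardLefschetzProperty a hHL hvan h0⟩

/-- **Every dual Lefschetz operator IS the abstract partner `ᶜΛ`** ("This `f` is then unique"), the Lefschetz
structure being the one forced by `Λ` itself (`Algebra.Lie.hasLefschetzProperty_of_isSl2Triple`); no hypothesis
beyond finite dimension. [cite: LooijengaLunts1997, §1 (1.1) p. 4 L4] -/
theorem IsDualLefschetz.eq_dual_self [Module.Finite K (totalCohomology K Y)] {N : ℕ}
    {a : singularCohomology K K Y 2} {Λ : Module.End K (totalCohomology K Y)} (hΛ : IsDualLefschetz N a Λ) :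
    Λ = (hasLefschetzProperty_of_isSl2Triple (isZGrading_degreeOperator N) hΛ).dual
      (isZGrading_degreeOperator N) :=
  (hasLefschetzProperty_of_isSl2Triple (isZGrading_degreeOperator N) hΛ).eq_dual_of_isSl2Triple
    (isZGrading_degreeOperator N) hΛ

end Literature.AlgebraicGeometry.Hyperkaehler

end
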